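import Summits.QuantumFields.YangMills.Theorems.BalabanUVNodesN20BlockCaricatureCountStatistic
import Mathlib.Analysis.PSeries

/-!
# BalabanUVNodes ∕ N20·N19′·N21 — THE ℓ¹∕ℓ^{1∕2} SQUEEZE IS STRICT AT BOTH ENDS (FILE G of the caricature series): one-block caricatures (`n_K = 1`, TV = `|q_K − p_K|` exactly) on which
# (a) `Σ_K Λ_K < ∞` yet NO dials give `HybridNE7` (FILE C's necessity letter is NOT sufficient) and (b) `Σ_K √Λ_K = ∞` yet SOME dials give `HybridNE7` (FILE C's sufficiency letter is
# NOT necessary) — the exact currency is the TOTAL VARIATION (FILE D), which CRIT-1's statistic determines only up to Le Cam's square-root gap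

Cell `pub-ymgap` (HUMAN RULING D-0062 Track A; work-bound push D-0149, director-ym №197), width seat `pub-ymgap-dag-n20-w1` (gen 5) on node N20 = NE7b; key item K3⁷
`SpineGivenEndpointR13SepCoPH` = stmt-QuantumFields-20544 (`--kind proof --supports 20544 --as helper`); COUNT-NEUTRAL.  Bus: CLAIM-14 ∕ INTENT-18 (INBOX l.32166).
THEOREMS ONLY: no `def`, no `instance`, no `notation`, no `sorry`; imports this seat's FILE F `…N20BlockCaricatureCountStatistic` (the exact criterion in count letters) and
`Mathlib.Analysis.PSeries` (the `p`-series tests `Real.summable_one_div_nat_pow`, `Real.not_summable_one_div_natCast`).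

WHY.  FILES C∕D bracket the caricature's stub-2 criterion (exact currency: summable binomial ℓ¹ = 2·TV, FILE D ∕ F) by CRIT-1's statistic: `Σ Λ_K < ∞` necessary, `Σ √Λ_K < ∞`
sufficient, and FILE D §4 identified these with the Hellinger road's `Σ(1 − bc)` ∕ `Σ H` letters.  Are the brackets an artefact of the proofs?  NO — both are STRICT, already on
ONE-BLOCK caricatures (`n_K = 1`: two classes `∅`, `{0}`; the count ℓ¹ is `2|q − p|`, §1): (a) `p_K = 1∕4`, `q_K = 1∕4 + 1∕(4(K+1))`: `Λ_K ≤ 3∕(16(K+1)²)` is summable while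
`ℓ¹_K = 1∕(2(K+1))` is not ⇒ NO `(Bad, W, shA, shB, Wsh, δ)` gives `HybridNE7` (FILE F's iff) although the necessity letter holds (§2 ★★ `necessityLetter_not_sufficient`) — the CLT-type
end, TV ≍ √Λ; (b) `p_K = 1∕(K+2)²`, `q_K = 2∕(K+2)²`: `ℓ¹_K = 2∕(K+2)²` is summable ⇒ SOME dials give `HybridNE7`, although `√Λ_K ≥ 1∕(√3·(K+2))` is not summable (§3 ★★
`sufficiencyLetter_not_necessary`) — the rare-block end, TV ≍ Λ (dag-n19-w2's fixed-ratio regime, ratio `2`).  So neither letter of the statistic can replace the total variation: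
the two regimes the cards discuss (window-key-core's (XG′) «CLT scale» vs the rare-block picture) sit at OPPOSITE ends of Le Cam's gap, and which one the RECORD is in stays undecided.
* §1 [folklore] `l1_count_one` (`n = 1`: the count ℓ¹ is `2|q − p|`) · `not_summable_inv_succ` (shifted harmonic series; the convergent `Σ 1∕(K+1)²` is inlined).
* §2 [folklore] ★★ `necessityLetter_not_sufficient` (sequence (a): `Summable Λ ∧ ¬ ∃ dials, HybridNE7`).
* §3 [folklore] ★★ `sufficiencyLetter_not_necessary` (sequence (b): `¬ Summable √Λ ∧ ∃ dials, HybridNE7`).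

HONEST FRAMING.  [folklore] two explicit numerical sequences on a ONE-BLOCK CARICATURE + `p`-series tests; sharpness of FILE C∕D's letters, nothing more; nothing read at the record
(`classSet₁₃ ∕ weightA₁₃ ∕ weightB₁₃` untouched; (LS)∕(XG′)∕(SAT′) at the record UNDECIDED); proves NO estimate of Bałaban's; refutes NO registered stub; nothing of Bałaban's asserted
or instantiated.  NE7 ∕ NE7b ∕ NE7c NOT PRINTED for `d = 4`, NOT proved; N19 ∕ N20 ∕ N21 NOT discharged; K3⁷ OPEN, skeleton v5 941dddb108cbaacf STANDS; counts unmoved (typed 28∕28 ·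
discharged 5∕27); no count claim.  One finite `𝕋⁴_{L^K}` programme at fixed `ε = L^{−K}`, Bałaban AS PRINTED; the YM mass gap (Clay) is NOT proved by any of this — R4 closes the
conditional finite-𝕋⁴ rung `BalabanLadder.UV` only; NOT ℝ⁴, NOT OS.  No decl carries a cite tag.
-/

set_option autoImplicit false

noncomputable section

open Finset
open Literature.MathematicalPhysics.QuantumFieldTheory.Balaban1983to89
open Literature.MathematicalPhysics.QuantumFieldTheory.Balaban1983to89.T4MatchingAssembly (HybridNE7)
open Summit.QuantumFields.YangMills.BalabanUVNodes.N20BlockCaricatureAffinity (stat₁_nonneg)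
open Summit.QuantumFields.YangMills.BalabanUVNodes.N20BlockCaricatureCountStatistic (exists_hybridNE7_caricature_iff_summable_l1_count)

namespace Summit.QuantumFields.YangMills.BalabanUVNodes.N20BlockCaricatureSqueezeSharp

/-! ## §1 One block: the count ℓ¹ is `2|q − p|`; shifted `p`-series tests -/

/-- On ONE block (`n = 1`) the ℓ¹ distance of the two count laws is `2|q − p|` (classes: no large field ∕ one large field). [folklore] -/
theorem l1_count_one (p q : ℝ) :
    ∑ k ∈ Finset.range (1 + 1), ((1 : ℕ).choose k : ℝ) * |q ^ k * (1 - q) ^ (1 - k) - p ^ k * (1 - p) ^ (1 - k)| = 2 * |q - p| := by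
  rw [Finset.sum_range_succ, Finset.sum_range_succ, Finset.sum_range_zero]
  simp only [Nat.choose_zero_right, Nat.choose_self, Nat.cast_one, one_mul, pow_zero, pow_one, Nat.sub_zero, Nat.sub_self, mul_one, zero_add]
  rw [show (1 - q) - (1 - p) = -(q - p) by ring, abs_neg]
  ring

/-- `Σ_K 1∕(K+1)` diverges (the harmonic series, shifted). [folklore] -/
theorem not_summable_inv_succ : ¬ Summable fun K : ℕ => 1 / ((K : ℝ) + 1) := by
  intro h
  have h' : Summable fun K : ℕ => (fun m : ℕ => 1 / (m : ℝ)) (K + 1) := by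
    simpa [Nat.cast_add, Nat.cast_one] using h
  exact Real.not_summable_one_div_natCast ((summable_nat_add_iff 1).1 h')

/-! ## §2 Sequence (a): the necessity letter `Σ Λ_K < ∞` holds, yet NO dials serve the faces -/

/-- ★★ **`Σ Λ_K < ∞` IS NOT SUFFICIENT** [folklore]: one block, `p_K = 1∕4`, `q_K = 1∕4 + 1∕(4(K+1))`.  The statistic `Λ_K ≤ 3∕(16(K+1)²)` is summable (the laws MERGE, FILE B; the
necessity letter of FILE C holds), but the ℓ¹ distance `1∕(2(K+1))` is NOT summable, so by FILE F's exact criterion NO `(Bad, W, shA, shB, Wsh, δ)` gives `HybridNE7` on this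
caricature (any `l₀ ≥ 0`, any `vol`).  The CLT-type end of Le Cam's gap: TV `≍ √Λ`. -/
theorem necessityLetter_not_sufficient {l₀ : ℝ} (hl₀ : 0 ≤ l₀) (vol : ℝ) :
    (Summable fun K : ℕ => (1 : ℕ) * (((1 / 4 + 1 / (4 * ((K : ℝ) + 1))) - 1 / 4) ^ 2 / (1 / 4 + (1 / 4 + 1 / (4 * ((K : ℝ) + 1)))) +
        ((1 / 4 + 1 / (4 * ((K : ℝ) + 1))) - 1 / 4) ^ 2 / (2 - 1 / 4 - (1 / 4 + 1 / (4 * ((K : ℝ) + 1)))))) ∧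
    ¬ ∃ (Bad : ℕ → ℝ → Finset (Finset ℕ)) (W : ℕ → ℝ) (shA shB : ℕ → ℝ → Finset ℕ → ℝ) (Wsh δ : ℕ → ℝ),
      HybridNE7 l₀ vol (fun _ => (Finset.range 1).powerset) (fun _ _ S => (1 / 4 : ℝ) ^ S.card * (1 - 1 / 4) ^ (1 - S.card))
        (fun K _ S => (1 / 4 + 1 / (4 * ((K : ℝ) + 1))) ^ S.card * (1 - (1 / 4 + 1 / (4 * ((K : ℝ) + 1)))) ^ (1 - S.card)) Bad W shA shB Wsh δ := by
  have hK : ∀ K : ℕ, (0 : ℝ) < (K : ℝ) + 1 := fun K => by positivity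
  -- `Σ 1∕(K+1)²` converges (shifted `p`-series; the tree's `Literature/NumberTheory/Transcendental/…` has it as `summable_one_div_nat_add_one_sq` — inlined, far module)
  have hsq : Summable fun K : ℕ => 1 / ((K : ℝ) + 1) ^ 2 := by
    have h := (summable_nat_add_iff 1).2 (Real.summable_one_div_nat_pow.2 one_lt_two)
    simpa [Nat.cast_add, Nat.cast_one] using h
  constructor
  · -- `Λ_K ≤ 3∕(16(K+1)²)`
    refine Summable.of_nonneg_of_le (fun K => ?_) (fun K => ?_) (hsq.mul_left (3 / 16))
    · have h1 : (0 : ℝ) ≤ 1 / 4 + 1 / (4 * ((K : ℝ) + 1)) := by positivity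
      have h2 : 1 / 4 + 1 / (4 * ((K : ℝ) + 1)) ≤ 1 := by
        have : 1 / (4 * ((K : ℝ) + 1)) ≤ 1 / 4 := by
          rw [div_le_div_iff₀ (by positivity) (by norm_num)]; nlinarith [hK K]
        linarith
      simpa using mul_nonneg (Nat.cast_nonneg 1) (stat₁_nonneg (p := (1 / 4 : ℝ)) (by norm_num) h1 (by norm_num) h2)
    · have e : (1 / 4 + 1 / (4 * ((K : ℝ) + 1))) - 1 / 4 = 1 / (4 * ((K : ℝ) + 1)) := by ring
      rw [Nat.cast_one, one_mul, e]
      have hx : 0 < 1 / (4 * ((K : ℝ) + 1)) := by positivity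
      have hx1 : 1 / (4 * ((K : ℝ) + 1)) ≤ 1 / 4 := by
        rw [div_le_div_iff₀ (by positivity) (by norm_num)]; nlinarith [hK K]
      set x : ℝ := 1 / (4 * ((K : ℝ) + 1)) with hxdef
      have hden1 : (1 : ℝ) / 2 ≤ 1 / 4 + (1 / 4 + x) := by linarith
      have hden2 : (1 : ℝ) ≤ 2 - 1 / 4 - (1 / 4 + x) := by linarith
      have hA : x ^ 2 / (1 / 4 + (1 / 4 + x)) ≤ x ^ 2 / (1 / 2) := div_le_div_of_nonneg_left (sq_nonneg x) (by norm_num) hden1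
      have hB : x ^ 2 / (2 - 1 / 4 - (1 / 4 + x)) ≤ x ^ 2 / 1 := div_le_div_of_nonneg_left (sq_nonneg x) one_pos hden2
      have hx2 : x ^ 2 = 1 / 16 * (1 / ((K : ℝ) + 1) ^ 2) := by rw [hxdef]; field_simp; ring
      calc x ^ 2 / (1 / 4 + (1 / 4 + x)) + x ^ 2 / (2 - 1 / 4 - (1 / 4 + x)) ≤ x ^ 2 / (1 / 2) + x ^ 2 / 1 := add_le_add hA hB
        _ = 3 / 16 * (1 / ((K : ℝ) + 1) ^ 2) := by rw [hx2]; ring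
  · -- the ℓ¹ distance `2|q − p| = 1∕(2(K+1))` is not summable
    rw [exists_hybridNE7_caricature_iff_summable_l1_count (fun _ => 1) (fun _ => (1 / 4 : ℝ)) (fun K => 1 / 4 + 1 / (4 * ((K : ℝ) + 1)))
      (fun K => ⟨by norm_num, by norm_num⟩) (fun K => ⟨by positivity, by
        have : 1 / (4 * ((K : ℝ) + 1)) ≤ 1 / 4 := by
          rw [div_le_div_iff₀ (by positivity) (by norm_num)]; nlinarith [hK K]
        linarith⟩) hl₀ vol]
    intro hs
    have e : ∀ K : ℕ, ∑ k ∈ Finset.range (1 + 1), ((1 : ℕ).choose k : ℝ) *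
        |(1 / 4 + 1 / (4 * ((K : ℝ) + 1))) ^ k * (1 - (1 / 4 + 1 / (4 * ((K : ℝ) + 1)))) ^ (1 - k) - (1 / 4 : ℝ) ^ k * (1 - 1 / 4) ^ (1 - k)| =
        1 / 2 * (1 / ((K : ℝ) + 1)) := fun K => by
      rw [l1_count_one, show (1 / 4 + 1 / (4 * ((K : ℝ) + 1))) - 1 / 4 = 1 / (4 * ((K : ℝ) + 1)) by ring,
        abs_of_pos (by positivity)]
      field_simp
      ring
    refine not_summable_inv_succ ?_
    have h2 := (hs.congr e).mul_left 2
    refine h2.congr fun K => ?_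
    ring

/-! ## §3 Sequence (b): the sufficiency letter `Σ √Λ_K < ∞` fails, yet SOME dials serve the faces -/

/-- ★★ **`Σ √Λ_K < ∞` IS NOT NECESSARY** [folklore]: one block, `p_K = 1∕(K+2)²`, `q_K = 2∕(K+2)²` (rare blocks, two-run odds ratio `2` — dag-n19-w2's fixed-ratio regime).  The ℓ¹
distance `2∕(K+2)²` is summable, so by FILE F's exact criterion SOME `(Bad, W, shA, shB, Wsh, δ)` give `HybridNE7` on this caricature; but `Λ_K ≥ (q−p)²∕(p+q) = 1∕(3(K+2)²)`, so
`√Λ_K ≥ 1∕(√3·(K+2))` is NOT summable — the sufficiency letter of FILE C fails.  The rare-block end of Le Cam's gap: TV `≍ Λ`. -/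
theorem sufficiencyLetter_not_necessary {l₀ : ℝ} (hl₀ : 0 ≤ l₀) (vol : ℝ) :
    (¬ Summable fun K : ℕ => Real.sqrt ((1 : ℕ) * ((2 / ((K : ℝ) + 2) ^ 2 - 1 / ((K : ℝ) + 2) ^ 2) ^ 2 / (1 / ((K : ℝ) + 2) ^ 2 + 2 / ((K : ℝ) + 2) ^ 2) +
        (2 / ((K : ℝ) + 2) ^ 2 - 1 / ((K : ℝ) + 2) ^ 2) ^ 2 / (2 - 1 / ((K : ℝ) + 2) ^ 2 - 2 / ((K : ℝ) + 2) ^ 2)))) ∧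
    ∃ (Bad : ℕ → ℝ → Finset (Finset ℕ)) (W : ℕ → ℝ) (shA shB : ℕ → ℝ → Finset ℕ → ℝ) (Wsh δ : ℕ → ℝ),
      HybridNE7 l₀ vol (fun _ => (Finset.range 1).powerset) (fun K _ S => (1 / ((K : ℝ) + 2) ^ 2) ^ S.card * (1 - 1 / ((K : ℝ) + 2) ^ 2) ^ (1 - S.card))
        (fun K _ S => (2 / ((K : ℝ) + 2) ^ 2) ^ S.card * (1 - 2 / ((K : ℝ) + 2) ^ 2) ^ (1 - S.card)) Bad W shA shB Wsh δ := by
  have hK2 : ∀ K : ℕ, (2 : ℝ) ≤ (K : ℝ) + 2 := fun K => by linarith [Nat.cast_nonneg (α := ℝ) K]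
  have hsq : ∀ K : ℕ, (4 : ℝ) ≤ ((K : ℝ) + 2) ^ 2 := fun K => by nlinarith [hK2 K]
  have hp : ∀ K : ℕ, 0 < 1 / ((K : ℝ) + 2) ^ 2 ∧ 1 / ((K : ℝ) + 2) ^ 2 < 1 := fun K =>
    ⟨by positivity, by rw [div_lt_one (by positivity)]; linarith [hsq K]⟩
  have hq : ∀ K : ℕ, 0 ≤ 2 / ((K : ℝ) + 2) ^ 2 ∧ 2 / ((K : ℝ) + 2) ^ 2 ≤ 1 := fun K =>
    ⟨by positivity, by rw [div_le_one (by positivity)]; linarith [hsq K]⟩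
  constructor
  · -- `√Λ_K ≥ 1∕(√3·(K+2)) ≥ (1∕2)·1∕(K+2)`: not summable
    intro hs
    have hlow : ∀ K : ℕ, 1 / 2 * (1 / ((K : ℝ) + 1 + 1)) ≤ Real.sqrt ((1 : ℕ) * ((2 / ((K : ℝ) + 2) ^ 2 - 1 / ((K : ℝ) + 2) ^ 2) ^ 2 /
        (1 / ((K : ℝ) + 2) ^ 2 + 2 / ((K : ℝ) + 2) ^ 2) +
        (2 / ((K : ℝ) + 2) ^ 2 - 1 / ((K : ℝ) + 2) ^ 2) ^ 2 / (2 - 1 / ((K : ℝ) + 2) ^ 2 - 2 / ((K : ℝ) + 2) ^ 2))) := fun K => by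
      rw [show (K : ℝ) + 1 + 1 = (K : ℝ) + 2 by ring]
      refine Real.le_sqrt_of_sq_le ?_
      set m : ℝ := ((K : ℝ) + 2) ^ 2 with hm
      have hm0 : 0 < m := by positivity
      have e1 : (2 / m - 1 / m) ^ 2 / (1 / m + 2 / m) = 1 / (3 * m) := by field_simp; ring
      have hnn : 0 ≤ (2 / m - 1 / m) ^ 2 / (2 - 1 / m - 2 / m) := div_nonneg (sq_nonneg _) (by
        have : 3 / m ≤ 3 / 4 := div_le_div_of_nonneg_left (by norm_num) (by norm_num) (hsq K)
        have e3 : 2 - 1 / m - 2 / m = 2 - 3 / m := by ring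
        rw [e3]; linarith)
      rw [Nat.cast_one, one_mul, e1]
      have e2 : (1 / 2 * (1 / ((K : ℝ) + 2))) ^ 2 = 1 / (4 * m) := by rw [hm]; field_simp; ring
      rw [e2]
      have : 1 / (4 * m) ≤ 1 / (3 * m) := div_le_div_of_nonneg_left (by norm_num) (by positivity) (by linarith)
      linarith
    have hsum : Summable fun K : ℕ => 1 / 2 * (1 / ((K : ℝ) + 1 + 1)) :=
      Summable.of_nonneg_of_le (fun K => by positivity) hlow hs
    have h1 : Summable fun K : ℕ => 1 / ((K : ℝ) + 1 + 1) := by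
      have := hsum.mul_left 2
      refine this.congr fun K => ?_
      ring
    have h2 : Summable fun K : ℕ => (fun m : ℕ => 1 / ((m : ℝ) + 1)) (K + 1) := by
      simpa [Nat.cast_add, Nat.cast_one, add_assoc] using h1
    exact not_summable_inv_succ ((summable_nat_add_iff 1).1 h2)
  · -- the ℓ¹ distance `2∕(K+2)²` is summable
    rw [exists_hybridNE7_caricature_iff_summable_l1_count (fun _ => 1) (fun K => 1 / ((K : ℝ) + 2) ^ 2) (fun K => 2 / ((K : ℝ) + 2) ^ 2) hp hq hl₀ vol]
    have e : ∀ K : ℕ, ∑ k ∈ Finset.range (1 + 1), ((1 : ℕ).choose k : ℝ) *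
        |(2 / ((K : ℝ) + 2) ^ 2) ^ k * (1 - 2 / ((K : ℝ) + 2) ^ 2) ^ (1 - k) - (1 / ((K : ℝ) + 2) ^ 2) ^ k * (1 - 1 / ((K : ℝ) + 2) ^ 2) ^ (1 - k)| =
        2 * (1 / ((K : ℝ) + 1 + 1) ^ 2) := fun K => by
      rw [l1_count_one, show 2 / ((K : ℝ) + 2) ^ 2 - 1 / ((K : ℝ) + 2) ^ 2 = 1 / ((K : ℝ) + 2) ^ 2 by ring, abs_of_pos (by positivity),
        show (K : ℝ) + 1 + 1 = (K : ℝ) + 2 by ring]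
    have h1 : Summable fun K : ℕ => 2 * (1 / ((K : ℝ) + 1 + 1) ^ 2) := by
      have hsq : Summable fun K : ℕ => 1 / ((K : ℝ) + 1) ^ 2 := by
        have h := (summable_nat_add_iff 1).2 (Real.summable_one_div_nat_pow.2 one_lt_two)
        simpa [Nat.cast_add, Nat.cast_one] using h
      have h := (summable_nat_add_iff 1).2 hsq
      have h' : Summable fun K : ℕ => 1 / ((K : ℝ) + 1 + 1) ^ 2 := by
        simpa [Nat.cast_add, Nat.cast_one] using h
      exact h'.mul_left 2
    exact h1.congr fun K => (e K).symm

end Summit.QuantumFields.YangMills.BalabanUVNodes.N20BlockCaricatureSqueezeSharp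

end
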